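import Mathlib.Topology.ContinuousMap.CompactlySupported
import Mathlib.Topology.ContinuousMap.SecondCountableSpace
import Mathlib.Topology.UniformSpace.CompactConvergence
import Mathlib.Topology.UrysohnsLemma
import Mathlib.Algebra.BigOperators.GroupWithZero.Action
import Mathlib.Logic.Equiv.List
import Mathlib.Data.Rat.Encodable
import HarnessLib

/-!
# A countable, rationally stable, dominated-dense test family in `C_c(X, ℝ)`

Topic `Literature/Probability/Distributions`; model-free bookkeeping written for the
Riesz–Markov step of the Garban–Pete–Schramm pivotal-kernel limit of lattice models (route
`Summits/CriticalPhenomena/CardyFormulaZ2/Theses/CardyMeckeFlip`, crux `FlipErgodicityZ2`, stub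
"joint multi-cutoff pivotal-kernel limit with a measurable kernel": a joint limit in law only sees
COUNTABLY many test functions `φ ∈ C_c(ℂ, ℝ)`, so the limit functionals `φ ↦ T φ` are a priori
defined, additive, `ℚ`-homogeneous and positive on a countable family `𝓓` only; to extend them to
positive linear functionals on all of `C_c` — and then to measures by Riesz–Markov–Kakutani — the
family must be dense in the DOMINATED sense `|f - g| ≤ η • χ` with `g, χ ∈ 𝓓`, `χ ≥ 0`, the
dominating `χ` depending only on a compact set carrying the support of `f`).

**Results** (`X` second countable, locally compact, regular — e.g. `ℂ`, `ℝⁿ`, any proper metric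
space):
* `exists_forall_abs_sub_lt_of_denseRange` — a family with dense range in `C(X, ℝ)` (compact-open
  topology) approximates every `f ∈ C(X, ℝ)` uniformly on every compact set;
* `exists_countable_ratSpan` — the rational linear combinations of a countable family in a real
  vector space form a countable set containing the family, closed under `+` and under `(q : ℝ) •`
  for `q ∈ ℚ`;
* `exists_countable_dominatedDense` — there is a countable `𝓓 ⊆ C_c(X, ℝ)`, closed under `+` and
  rational multiples, such that every compact `K` has a cutoff `χ ∈ 𝓓`, `0 ≤ χ ≤ 1`, `χ = 1` on
  `K`, with: for every `f ∈ C_c(X, ℝ)` supported in `K` and every `η > 0` some `g ∈ 𝓓` satisfies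
  `|f x - g x| ≤ η * χ x` for all `x` (so also `‖f - g‖_∞ ≤ η` and `support g ⊆ support χ`);
* `exists_countable_testFamily` — the weaker packaging "countable, `+`-closed, `ℚ`-stable,
  dominating every compact set, and `∀ f, ∀ η > 0, ∃ g χ ∈ 𝓓, 0 ≤ χ ∧ |f - g| ≤ η χ`" (for
  extension/Cauchy arguments use `exists_countable_dominatedDense`, whose dominating `χ` does not
  depend on `η`).

Construction: `K n` a compact exhaustion, `χ n ∈ C_c` Urysohn cutoffs (`= 1` on `K n`), `d i` a
dense sequence of `C(X, ℝ)` (which is second countable for the compact-open topology, Mathlib's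
`ContinuousMap.instSecondCountableTopology`); `𝓓` is the rational span of `{χ n} ∪ {d i * χ n}`.
For `f` supported in `K ⊆ K n` one has `f = f * χ n`, so `|f - d i * χ n| = |f - d i| * χ n ≤ η χ n`
as soon as `|f - d i| < η` on the compact set `tsupport (χ n)`.

No named fact, no new definition; Mathlib only.  NOT here: the extension of positive
`ℚ`-linear functionals from `𝓓` to `C_c` and their Riesz–Markov representation (a separate file),
vague-topology statements, Stone–Weierstrass descriptions of `𝓓` (polynomial cut-offs).

## References

Standard (separability of `C_c(X)` for second countable locally compact `X` in the inductive-limit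
sense); cf. O. Kallenberg, *Random Measures, Theory and Applications* (2017), §4.1, and
H. Bauer, *Measure and Integration Theory* (2001), §31 (vague convergence, countable dense
subclasses of `C_c`).
-/

noncomputable section

open Set Filter Function TopologicalSpace
open _root_.Topology
open scoped CompactlySupported Uniformity

namespace Literature.Probability.Distributions

section Approximation

variable {X : Type*} [TopologicalSpace X]

/-- **Uniform approximation on compact sets from density in the compact-open topology.**  If
`g : ι → C(X, ℝ)` has dense range (compact-open topology), then for every `f ∈ C(X, ℝ)`, every
compact `K ⊆ X` and every `η > 0` some `g i` satisfies `|f x - g i x| < η` for all `x ∈ K`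
(the sets `{h | ∀ x ∈ K, dist (f x) (h x) < η}` are neighbourhoods of `f`: the compact-open
topology is the topology of compact convergence). [folklore] -/
theorem exists_forall_abs_sub_lt_of_denseRange {ι : Type*} {g : ι → C(X, ℝ)} (hg : DenseRange g)
    (f : C(X, ℝ)) {K : Set X} (hK : IsCompact K) {η : ℝ} (hη : 0 < η) :
    ∃ i, ∀ x ∈ K, |f x - g i x| < η := by
  have hE : {fh : C(X, ℝ) × C(X, ℝ) |
      ∀ x ∈ K, (fh.1 x, fh.2 x) ∈ {p : ℝ × ℝ | dist p.1 p.2 < η}} ∈ 𝓤 C(X, ℝ) :=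
    ContinuousMap.hasBasis_compactConvergenceUniformity.mem_of_mem
      (i := (K, {p : ℝ × ℝ | dist p.1 p.2 < η})) ⟨hK, Metric.dist_mem_uniformity hη⟩
  obtain ⟨i, hi⟩ := hg.mem_nhds (UniformSpace.ball_mem_nhds f hE)
  refine ⟨i, fun x hx => ?_⟩
  have h : dist (f x) (g i x) < η := hi x hx
  rwa [Real.dist_eq] at h

end Approximation

section RatSpan

/-- **Rational span of a countable family.**  In a real vector space, the set of all finite sums
`∑ₖ (qₖ : ℝ) • v iₖ` (`qₖ ∈ ℚ`) over a countable index type is countable, contains every `v i`,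
and is closed under addition and under multiplication by (real casts of) rationals. [folklore] -/
theorem exists_countable_ratSpan {ι M : Type*} [Countable ι] [AddCommMonoid M] [Module ℝ M]
    (v : ι → M) :
    ∃ 𝓓 : Set M, 𝓓.Countable ∧ (∀ i, v i ∈ 𝓓) ∧ (∀ f ∈ 𝓓, ∀ g ∈ 𝓓, f + g ∈ 𝓓) ∧
      ∀ (q : ℚ), ∀ f ∈ 𝓓, (q : ℝ) • f ∈ 𝓓 := by
  classical
  let Φ : List (ℚ × ι) → M := fun l => (l.map fun p => (p.1 : ℝ) • v p.2).sum
  refine ⟨range Φ, countable_range Φ, fun i => ⟨[(1, i)], by simp [Φ]⟩, ?_, ?_⟩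
  · rintro _ ⟨l₁, rfl⟩ _ ⟨l₂, rfl⟩
    exact ⟨l₁ ++ l₂, by simp [Φ]⟩
  · rintro q _ ⟨l, rfl⟩
    exact ⟨l.map fun p => (q * p.1, p.2), by
      simp [Φ, List.smul_sum, List.map_map, Function.comp_def, mul_smul]⟩

end RatSpan

section TestFamily

/-- **A countable, rationally stable, dominated-dense family in `C_c(X, ℝ)`.**  On a second
countable, locally compact, regular space `X` there is a countable `𝓓 ⊆ C_c(X, ℝ)`, closed under
`+` and under rational multiples, such that every compact `K` admits a cutoff `χ ∈ 𝓓` with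
`0 ≤ χ ≤ 1`, `χ = 1` on `K`, and for every `f ∈ C_c(X, ℝ)` with `support f ⊆ K` and every
`η > 0` some `g ∈ 𝓓` has `|f x - g x| ≤ η * χ x` for all `x` (the rational span of
`{χₙ} ∪ {dᵢ χₙ}`, `χₙ` Urysohn cutoffs of a compact exhaustion, `(dᵢ)` dense in `C(X, ℝ)`).
[folklore] -/
theorem exists_countable_dominatedDense (X : Type*) [TopologicalSpace X]
    [SecondCountableTopology X] [LocallyCompactSpace X] [RegularSpace X] :
    ∃ 𝓓 : Set C_c(X, ℝ), 𝓓.Countable ∧ (∀ f ∈ 𝓓, ∀ g ∈ 𝓓, f + g ∈ 𝓓) ∧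
      (∀ (q : ℚ), ∀ f ∈ 𝓓, (q : ℝ) • f ∈ 𝓓) ∧
      ∀ K : Set X, IsCompact K → ∃ χ ∈ 𝓓, (∀ x, χ x ∈ Icc (0 : ℝ) 1) ∧ (∀ x ∈ K, χ x = 1) ∧
        ∀ f : C_c(X, ℝ), support f ⊆ K → ∀ η : ℝ, 0 < η →
          ∃ g ∈ 𝓓, ∀ x, |f x - g x| ≤ η * χ x := by
  classical
  -- a compact exhaustion and Urysohn cutoffs `χ n = 1` on `K n`
  set K : CompactExhaustion X := CompactExhaustion.choice X
  have hcut : ∀ n : ℕ, ∃ χ : C(X, ℝ), EqOn χ 1 (K n) ∧ HasCompactSupport χ ∧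
      ∀ x, χ x ∈ Icc (0 : ℝ) 1 := fun n => by
    obtain ⟨χ, h1, -, hc, h01⟩ := exists_continuous_one_zero_of_isCompact (K.isCompact n)
      isClosed_empty (disjoint_empty _)
    exact ⟨χ, h1, hc, h01⟩
  choose χ hχ1 hχc hχ01 using hcut
  have hχ1' : ∀ n, ∀ x ∈ K n, χ n x = 1 := fun n x hx => by
    simpa only [Pi.one_apply] using hχ1 n hx
  -- a dense sequence of `C(X, ℝ)` for the compact-open topology
  set d : ℕ → C(X, ℝ) := denseSeq C(X, ℝ)
  have hd : DenseRange d := denseRange_denseSeq _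
  -- the generators `χ n` and `d i * χ n`, as compactly supported functions
  obtain ⟨v, hv0, hv1⟩ : ∃ v : Option ℕ × ℕ → C_c(X, ℝ),
      (∀ n x, v (none, n) x = χ n x) ∧ ∀ i n x, v (some i, n) x = d i x * χ n x :=
    ⟨fun p => Option.elim p.1 (⟨χ p.2, hχc p.2⟩ : C_c(X, ℝ))
        (fun i => (⟨d i * χ p.2, (hχc p.2).mul_left⟩ : C_c(X, ℝ))),
      fun _ _ => rfl, fun _ _ _ => rfl⟩
  -- their rational span
  obtain ⟨𝓓, h𝓓c, hv𝓓, hadd, hsmul⟩ := exists_countable_ratSpan v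
  refine ⟨𝓓, h𝓓c, hadd, hsmul, fun L hL => ?_⟩
  obtain ⟨n, hn⟩ := K.exists_superset_of_isCompact hL
  refine ⟨v (none, n), hv𝓓 _, fun x => ?_, fun x hx => ?_, fun f hf η hη => ?_⟩
  · rw [hv0]; exact hχ01 n x
  · rw [hv0]; exact hχ1' n x (hn hx)
  · -- approximate `f` by some `d i` within `η` on the compact set `tsupport (χ n)`
    obtain ⟨i, hi⟩ :=
      exists_forall_abs_sub_lt_of_denseRange hd f.toContinuousMap (hχc n) hη
    refine ⟨v (some i, n), hv𝓓 _, fun x => ?_⟩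
    have h01 := hχ01 n x
    -- `f = f * χ n` since `χ n = 1` on `K n ⊇ L ⊇ support f`
    have hfx : f x * χ n x = f x := by
      by_cases hx0 : f x = 0
      · rw [hx0, zero_mul]
      · rw [hχ1' n x (hn (hf hx0)), mul_one]
    have hle : |f x - d i x| * χ n x ≤ η * χ n x := by
      by_cases hx : x ∈ tsupport (χ n)
      · exact mul_le_mul_of_nonneg_right (hi x hx).le h01.1
      · rw [image_eq_zero_of_notMem_tsupport hx, mul_zero, mul_zero]
    calc |f x - v (some i, n) x| = |(f x - d i x) * χ n x| := by rw [hv1, sub_mul, hfx]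
      _ = |f x - d i x| * χ n x := by rw [abs_mul, abs_of_nonneg h01.1]
      _ ≤ η * v (none, n) x := by rw [hv0]; exact hle

/-- **Countable dominating-dense `ℚ`-stable test family** (the packaging used for pivotal-kernel
limits).  On a second countable, locally compact, regular space `X` there is a countable
`𝓓 ⊆ C_c(X, ℝ)` which is closed under `+` and under rational multiples, contains for every
compact `K` a non-negative `χ` with `χ ≥ 1` on `K`, and is dense in the dominated sense: for all
`f ∈ C_c(X, ℝ)` and `η > 0` there are `g, χ ∈ 𝓓`, `χ ≥ 0`, with `|f x - g x| ≤ η * χ x` for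
all `x`. [folklore] -/
theorem exists_countable_testFamily (X : Type*) [TopologicalSpace X]
    [SecondCountableTopology X] [LocallyCompactSpace X] [RegularSpace X] :
    ∃ 𝓓 : Set C_c(X, ℝ), 𝓓.Countable ∧ (∀ f ∈ 𝓓, ∀ g ∈ 𝓓, f + g ∈ 𝓓) ∧
      (∀ (q : ℚ), ∀ f ∈ 𝓓, (q : ℝ) • f ∈ 𝓓) ∧
      (∀ K : Set X, IsCompact K → ∃ χ ∈ 𝓓, (∀ x, 0 ≤ χ x) ∧ ∀ x ∈ K, 1 ≤ χ x) ∧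
      ∀ (f : C_c(X, ℝ)) (η : ℝ), 0 < η →
        ∃ g ∈ 𝓓, ∃ χ ∈ 𝓓, (∀ x, 0 ≤ χ x) ∧ ∀ x, |f x - g x| ≤ η * χ x := by
  obtain ⟨𝓓, h𝓓c, hadd, hsmul, hK⟩ := exists_countable_dominatedDense X
  refine ⟨𝓓, h𝓓c, hadd, hsmul, fun K hK' => ?_, fun f η hη => ?_⟩
  · obtain ⟨χ, hχ, h01, h1, -⟩ := hK K hK'
    exact ⟨χ, hχ, fun x => (h01 x).1, fun x hx => (h1 x hx).ge⟩
  · obtain ⟨χ, hχ, h01, -, happrox⟩ := hK (tsupport f) f.hasCompactSupport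
    obtain ⟨g, hg, hfg⟩ := happrox f (subset_tsupport _) η hη
    exact ⟨g, hg, χ, hχ, fun x => (h01 x).1, hfg⟩

end TestFamily

end Literature.Probability.Distributions

end
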